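import Literature.AnabelianGeometry.EtaleTheta.ConstantMultipleRigidityUniqueProofs
import Literature.AnabelianGeometry.EtaleTheta.ConstantMultipleRigidityEquivarianceProofs
import HarnessLib

/-!
# [EtTh] Thm. 1.10 (i) as SCHEMATA over the §1 interface: the exact criterion for the typed
# `Thm110iUnique` (FROZEN FACT-LIST row F-0513) and the same-setting reading of `Thm110i` (F-0512)
# in terms of the minimal-norm values of `η̈^{Θ,Z}` at the two points `τ`, `τ⁻¹` (proof-only)

S. Mochizuki, *The étale theta function and its Frobenioid-theoretic manifestations*, Publ. RIMS **45**
(2009), §1, Def. 1.9 (i)(ii) and Thm. 1.10 (i), PRIMS PDF pp. 29–30 (printed 255–256)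
[cite: MochizukiEtTh2009, Thm 1.10 (i) p.29]: «a property that determines this collection of classes up to
multiplication by `±1`». abc-iut cell, block F, seat abc-iut-f-113 (gen 2), tranche 113 (successor item of
the gen-0 HANDOFF «schema tests of `Thm110i`/`Thm110iUnique`», the model-free half). PROOF-ONLY companion
(no `def`, no instance, no new named fact) of abc-iut-L2-t1's `ConstantMultipleRigidity.lean` (`Thm110i`,
`Thm110iUnique`, `MuTwoSetting.valuesAt`, `IsOfStandardType`) and abc-iut-w5-d140's
`ConstantMultipleRigiditySub.lean` / `…UniqueProofs.lean` ((V2′) `Thm110UnitClassEquivariance`, (b₁)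
`StandardValuesNormInjective`, (b₂) `StandardValuesInvSymm`, `MuTwoSetting.valuesAt_unitMul`), with
abc-iut-w5-d234's `thm110UnitClassEquivariance_of_prop15ii` — all consumed BY NAME, nothing restated.

WHY. F-0512/F-0513 are PARAMETRISED schemata (R5) on an abstract `MuTwoSetting` whose Def. 1.9 data
`S : StandardData` — the points `τ`, `τ⁻¹` with their evaluation maps — are FREE (`NonCuspidalPoint.evalAt`
is pinned only on Kummer classes of constants). The tree holds SUFFICIENT routes to `Thm110iUnique`
(`thm110iUnique_of_signedFormula`, `…_of_prop15iii`, `…_anchored_of_deck`, …) and the vacuous verdict at the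
root model (`SettingModel.thm110iUnique_rootModel`); a non-vacuous test of the ∀-closure waits for a
Kummer-carrying model (R78 cluster). THIS FILE settles the model-free part — WHAT EXACTLY the ∀-closure
asks of the free data — under (V2′) (the unit Kummer classes `κ(u)`, `u ∈ O^×_{K̈}`, are fixed by the
orbit group; a THEOREM modulo [EtTh] Prop. 1.5 (ii)). Write `V(x, y) := valuesAt hC εZ x y ⊆ K̈^×`
(Def. 1.9 (i)) and call `m ∈ V(x, y)` MINIMAL if `‖m‖ ≤ ‖w‖` for all `w ∈ V(x, y)` («the unique value …
of maximal order», Def. 1.9 (ii); spelled out inline, no definition introduced). RESULTS: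
* `isOfStandardType_iff_exists_minimal` — standard type ⟺ `±1` is a minimal value at `τ` or at `τ⁻¹`;
* `minimal_unitMul_iff` / `isOfStandardType_unitMul_iff` — the minimal values of `(u·η̈)^{Θ,Z}` are `u ·`
  those of `η̈^{Θ,Z}`; `(u·η̈)^{Θ,Z}` is of standard type ⟺ `±u⁻¹` is a minimal value of `η̈^{Θ,Z}`;
* **`thm110iUnique_iff_minimal_values`** (+ `…_of_prop15ii`) — `Thm110iUnique hC hZ E S` ⟺ «if `±1` is a
  minimal value of `η̈^{Θ,Z}` at `τ` or `τ⁻¹`, then EVERY UNIT minimal value at `τ` or `τ⁻¹` is `±1`»;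
* **`not_thm110iUnique_of_minimal_values`** — the REFUTATION SHAPE of the ∀-closure: the minimal value
  `±1` at one of the points next to a unit minimal value `≠ ±1` at one of them (gen 0's «twisted `τ⁻¹`»
  recipe; print forces `V(η̈, τ⁻¹) = −V(η̈, τ)` by Prop. 1.4 (ii), the typed interface does not);
* **`thm110iUnique_of_normInjective_of_invSymm`** (+ `…_of_prop15ii`) — a NEW sufficient route from (b₁)
  (distinct absolute values at `τ`) and (b₂) (`V(η̈, τ⁻¹) = −V(η̈, τ)`) ONLY — no value formula (V1′/V1″), no
  orbit generator, no anchored data (`exists_minimal_tau_of_invSymm`: every minimal value at either point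
  is `±` THE minimal value at `τ`);
* `thm110i_iff_minimal_values_of_same_setting`, `not_thm110i_of_minimal_values` — F-0512 over ONE setting
  and ONE étale theta datum (any hypothesis structure): `Thm110i H Sα Sβ` ⟺ «`±1` is a minimal value» has
  the same truth value for `Sα` and `Sβ`.
So at any future model the ∀-closures of F-0512/F-0513 are decided by listing the minimal values of
`η̈^{Θ,Z}` at the candidate points. HONEST FRAMING: statements about OUR typed schemata; characterising or
refuting a typed schema says nothing about [EtTh] Thm. 1.10, which concerns actual curves with their actual
evaluation maps; typed ≠ proved; no side is taken on [IUTchIII] Cor. 3.12 or on any author.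
-/

noncomputable section

namespace Literature.AnabelianGeometry.EtaleTheta

namespace MuTwoSetting

variable {p : ℕ} [Fact p.Prime] {M : MuTwoSetting p}

/-! ### Def. 1.9 (ii) unfolded: standard type = «`±1` is a minimal value at `τ` or at `τ⁻¹`» -/

/-- **Def. 1.9 (ii), unfolded over the two standard sets of values** (p. 29: «the unique value … of
maximal order of some standard set of values of `η̈^{Θ,Z}` is equal to `±1`»): `η̈^{Θ,Z}` is of standard
type iff at one of the two points `y ∈ {τ, τ⁻¹}` some value of minimal absolute value equals `±1` (the
unit clause being automatic, `isOfStandardType_iff_exists_eq_one_or_neg_one`).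
[cite: MochizukiEtTh2009, Def 1.9 (ii) p.29] -/
theorem isOfStandardType_iff_exists_minimal {E : M.toThetaSetting.KummerData}
    (hC : M.toThetaSetting.Compat) (εZ : M.GtpC) (S : M.StandardData E)
    (x : M.toThetaSetting.H1 M.toThetaSetting.GtpYdd) :
    M.IsOfStandardType hC εZ S x ↔
      ∃ y : ThetaSetting.NonCuspidalPoint E, (y = S.tau ∨ y = S.tauInv) ∧
        ∃ m ∈ valuesAt hC εZ x y,
          (∀ w ∈ valuesAt hC εZ x y, ‖((m : M.Kdd) : PadicAlgCl p)‖ ≤ ‖((w : M.Kdd) : PadicAlgCl p)‖) ∧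
          (((m : M.Kdd) : PadicAlgCl p) = 1 ∨ ((m : M.Kdd) : PadicAlgCl p) = -1) := by
  rw [isOfStandardType_iff_exists_eq_one_or_neg_one]
  constructor
  · rintro ⟨V, hV, v, hv, hmin, hpm⟩
    rcases hV with rfl | rfl
    · exact ⟨S.tau, Or.inl rfl, v, hv, hmin, hpm⟩
    · exact ⟨S.tauInv, Or.inr rfl, v, hv, hmin, hpm⟩
  · rintro ⟨y, hy, m, hm, hmin, hpm⟩
    rcases hy with rfl | rfl
    · exact ⟨_, Or.inl rfl, m, hm, hmin, hpm⟩
    · exact ⟨_, Or.inr rfl, m, hm, hmin, hpm⟩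

/-! ### The minimal values of `(u·η̈)^{Θ,Z}` are `u ·` the minimal values of `η̈^{Θ,Z}` -/

variable {E : M.toThetaSetting.KummerData}

/-- The absolute value of `u⁻¹ · v` equals that of `v` for `u ∈ O^×_{K̈}`. [cite: MochizukiEtTh2009, §1 p.17] -/
theorem norm_coe_inv_mul_of_mem_unitsOKdd {u : (↥M.Kdd)ˣ} (hu : u ∈ M.toThetaSetting.unitsOKdd)
    (v : (↥M.Kdd)ˣ) :
    ‖(((u⁻¹ * v : (↥M.Kdd)ˣ) : M.Kdd) : PadicAlgCl p)‖ = ‖((v : M.Kdd) : PadicAlgCl p)‖ := by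
  rw [coe_units_mul, norm_mul, norm_coe_eq_one_of_mem_unitsOKdd (M.toThetaSetting.unitsOKdd.inv_mem hu),
    one_mul]

/-- The absolute value of `u · v` equals that of `v` for `u ∈ O^×_{K̈}`. [cite: MochizukiEtTh2009, §1 p.17] -/
theorem norm_coe_mul_of_mem_unitsOKdd {u : (↥M.Kdd)ˣ} (hu : u ∈ M.toThetaSetting.unitsOKdd)
    (v : (↥M.Kdd)ˣ) :
    ‖(((u * v : (↥M.Kdd)ˣ) : M.Kdd) : PadicAlgCl p)‖ = ‖((v : M.Kdd) : PadicAlgCl p)‖ := by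
  rw [coe_units_mul, norm_mul, norm_coe_eq_one_of_mem_unitsOKdd hu, one_mul]

/-- **Minimal values of the translate** (Def. 1.9 (ii) for `(u·η̈)^{Θ,Z}`, `u ∈ O^×_{K̈}`), granted (V2′):
`v` is a value of minimal absolute value of `(u·η̈)^{Θ,Z}` at `y` iff `u⁻¹·v` is one of `η̈^{Θ,Z}` at `y`
(`valuesAt_unitMul`: the value sets differ by the factor `u`, of absolute value `1`).
[cite: MochizukiEtTh2009, Def 1.9 (ii) p.29] -/
theorem minimal_unitMul_iff (hC : M.toThetaSetting.Compat) (εZ : M.GtpC)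
    (hV2 : Thm110UnitClassEquivariance hC εZ E) {u : (↥M.Kdd)ˣ} (hu : u ∈ M.toThetaSetting.unitsOKdd)
    (x : M.toThetaSetting.H1 M.toThetaSetting.GtpYdd) (y : ThetaSetting.NonCuspidalPoint E)
    (v : (↥M.Kdd)ˣ) :
    (v ∈ valuesAt hC εZ (M.toThetaSetting.inflTheta M.toThetaSetting.GtpYdd (E.kumYdd (E.toKddHat u)) * x) y ∧
      ∀ w ∈ valuesAt hC εZ
          (M.toThetaSetting.inflTheta M.toThetaSetting.GtpYdd (E.kumYdd (E.toKddHat u)) * x) y,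
        ‖((v : M.Kdd) : PadicAlgCl p)‖ ≤ ‖((w : M.Kdd) : PadicAlgCl p)‖) ↔
    (u⁻¹ * v ∈ valuesAt hC εZ x y ∧
      ∀ w ∈ valuesAt hC εZ x y,
        ‖(((u⁻¹ * v : (↥M.Kdd)ˣ) : M.Kdd) : PadicAlgCl p)‖ ≤ ‖((w : M.Kdd) : PadicAlgCl p)‖) := by
  rw [valuesAt_unitMul hC εZ hV2 hu, norm_coe_inv_mul_of_mem_unitsOKdd hu]
  refine and_congr_right fun _ => ⟨fun h w hw => ?_, fun h w hw => ?_⟩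
  · have hw' : u * w ∈ valuesAt hC εZ
        (M.toThetaSetting.inflTheta M.toThetaSetting.GtpYdd (E.kumYdd (E.toKddHat u)) * x) y := by
      rw [valuesAt_unitMul hC εZ hV2 hu, inv_mul_cancel_left]; exact hw
    have key := h (u * w) hw'
    rwa [norm_coe_mul_of_mem_unitsOKdd hu] at key
  · have key := h (u⁻¹ * w) ((valuesAt_unitMul hC εZ hV2 hu x y w).mp hw)
    rwa [norm_coe_inv_mul_of_mem_unitsOKdd hu] at key

/-- **Standard type of the translate `(u·η̈)^{Θ,Z}`** (`u ∈ O^×_{K̈}`), granted (V2′): it holds iff at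
`τ` or at `τ⁻¹` some minimal value `m` of `η̈^{Θ,Z}` satisfies `u·m = ±1` (i.e. `m = ±u⁻¹`).
[cite: MochizukiEtTh2009, Thm 1.10 (i) p.29] -/
theorem isOfStandardType_unitMul_iff (hC : M.toThetaSetting.Compat) (εZ : M.GtpC)
    (hV2 : Thm110UnitClassEquivariance hC εZ E) {u : (↥M.Kdd)ˣ} (hu : u ∈ M.toThetaSetting.unitsOKdd)
    (S : M.StandardData E) (x : M.toThetaSetting.H1 M.toThetaSetting.GtpYdd) :
    M.IsOfStandardType hC εZ S
        (M.toThetaSetting.inflTheta M.toThetaSetting.GtpYdd (E.kumYdd (E.toKddHat u)) * x) ↔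
      ∃ y : ThetaSetting.NonCuspidalPoint E, (y = S.tau ∨ y = S.tauInv) ∧
        ∃ m ∈ valuesAt hC εZ x y,
          (∀ w ∈ valuesAt hC εZ x y, ‖((m : M.Kdd) : PadicAlgCl p)‖ ≤ ‖((w : M.Kdd) : PadicAlgCl p)‖) ∧
          (((u : M.Kdd) : PadicAlgCl p) * ((m : M.Kdd) : PadicAlgCl p) = 1 ∨
            ((u : M.Kdd) : PadicAlgCl p) * ((m : M.Kdd) : PadicAlgCl p) = -1) := by
  rw [isOfStandardType_iff_exists_minimal]
  refine exists_congr fun y => and_congr_right fun _ => ⟨?_, ?_⟩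
  · rintro ⟨v, hv, hmin, hpm⟩
    have key := (minimal_unitMul_iff hC εZ hV2 hu x y v).mp ⟨hv, hmin⟩
    refine ⟨u⁻¹ * v, key.1, key.2, ?_⟩
    rwa [← coe_units_mul, mul_inv_cancel_left]
  · rintro ⟨m, hm, hmin, hpm⟩
    have key := (minimal_unitMul_iff hC εZ hV2 hu x y (u * m)).mpr
      (by rw [inv_mul_cancel_left]; exact ⟨hm, hmin⟩)
    refine ⟨u * m, key.1, key.2, ?_⟩
    rwa [coe_units_mul]

/-! ### F-0513 `Thm110iUnique`: the exact criterion on the minimal values at `τ`, `τ⁻¹` -/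

/-- Sign bookkeeping in `ℚ̄_p`: from `a·b = ±1` and `b = ±1` conclude `a = ±1`. [folklore] -/
private theorem eq_one_or_neg_one_of_mul_of_right {a b : PadicAlgCl p} (hab : a * b = 1 ∨ a * b = -1)
    (hb : b = 1 ∨ b = -1) : a = 1 ∨ a = -1 := by
  rcases hb with rfl | rfl <;> rcases hab with h | h
  · left; linear_combination h
  · right; linear_combination h
  · right; linear_combination -h
  · left; linear_combination -h

/-- A value `m` with `u·m = ±1` for a unit `u ∈ O^×_{K̈}` is itself a unit. [cite: MochizukiEtTh2009, §1 p.17] -/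
theorem mem_unitsOKdd_of_unit_mul_eq {u m : (↥M.Kdd)ˣ} (hu : u ∈ M.toThetaSetting.unitsOKdd)
    (hum : ((u : M.Kdd) : PadicAlgCl p) * ((m : M.Kdd) : PadicAlgCl p) = 1 ∨
      ((u : M.Kdd) : PadicAlgCl p) * ((m : M.Kdd) : PadicAlgCl p) = -1) :
    m ∈ M.toThetaSetting.unitsOKdd := by
  have h1 : ‖((u : M.Kdd) : PadicAlgCl p) * ((m : M.Kdd) : PadicAlgCl p)‖ = 1 := by
    rcases hum with h | h
    · rw [h, norm_one]
    · rw [h, norm_neg, norm_one]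
  rw [norm_mul, norm_coe_eq_one_of_mem_unitsOKdd hu, one_mul] at h1
  exact h1

/-- **F-0513 — THE CRITERION.** Granted (V2′) `Thm110UnitClassEquivariance`, the typed uniqueness clause
of Thm. 1.10 (i), `Thm110iUnique hC hZ E S` («if `η̈^{Θ,Z}` and `(u·η̈)^{Θ,Z}`, `u ∈ O^×_{K̈}`, are both of
standard type then `u = ±1`»), is EQUIVALENT to the following property of the minimal-norm values of
`η̈^{Θ,Z}` at the two free points `τ`, `τ⁻¹` of the standard datum: IF `±1` is a minimal value at `τ` or
at `τ⁻¹` (i.e. `η̈^{Θ,Z}` is of standard type), THEN every minimal value at `τ` or at `τ⁻¹` lying in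
`O^×_{K̈}` equals `±1`. (→: a unit minimal value `m` makes `(m⁻¹·η̈)^{Θ,Z}` of standard type; ←: a standard
translate `(u·η̈)^{Θ,Z}` exhibits the unit minimal value `±u⁻¹`.) [cite: MochizukiEtTh2009, Thm 1.10 (i) p.29] -/
theorem thm110iUnique_iff_minimal_values (hC : M.toThetaSetting.Compat) {εZ : M.GtpC}
    (hZ : M.IsAdmissibleEpsZ εZ) (E : M.toThetaSetting.EtaleThetaData)
    (S : M.StandardData E.toKummerData)
    (hV2 : Thm110UnitClassEquivariance hC εZ E.toKummerData) :
    Thm110iUnique hC hZ E S ↔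
      ((∃ y : ThetaSetting.NonCuspidalPoint E.toKummerData, (y = S.tau ∨ y = S.tauInv) ∧
          ∃ m ∈ valuesAt hC εZ E.etaDd y,
            (∀ w ∈ valuesAt hC εZ E.etaDd y,
              ‖((m : M.Kdd) : PadicAlgCl p)‖ ≤ ‖((w : M.Kdd) : PadicAlgCl p)‖) ∧
            (((m : M.Kdd) : PadicAlgCl p) = 1 ∨ ((m : M.Kdd) : PadicAlgCl p) = -1)) →
        ∀ y : ThetaSetting.NonCuspidalPoint E.toKummerData, (y = S.tau ∨ y = S.tauInv) →
          ∀ m ∈ valuesAt hC εZ E.etaDd y,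
            (∀ w ∈ valuesAt hC εZ E.etaDd y,
              ‖((m : M.Kdd) : PadicAlgCl p)‖ ≤ ‖((w : M.Kdd) : PadicAlgCl p)‖) →
            m ∈ M.toThetaSetting.unitsOKdd →
            (((m : M.Kdd) : PadicAlgCl p) = 1 ∨ ((m : M.Kdd) : PadicAlgCl p) = -1)) := by
  constructor
  · intro hU hstd y hy m hm hmin hunit
    -- `u := m⁻¹` is a unit and `(u·η̈)^{Θ,Z}` is of standard type, witnessed by `m` itself at `y`
    have hu : m⁻¹ ∈ M.toThetaSetting.unitsOKdd := M.toThetaSetting.unitsOKdd.inv_mem hunit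
    have hum : (((m⁻¹ : (↥M.Kdd)ˣ) : M.Kdd) : PadicAlgCl p) * ((m : M.Kdd) : PadicAlgCl p) = 1 := by
      rw [← coe_units_mul, inv_mul_cancel]; rfl
    have hstd' := (isOfStandardType_unitMul_iff hC εZ hV2 hu S E.etaDd).mpr
      ⟨y, hy, m, hm, hmin, Or.inl hum⟩
    have hpm := hU m⁻¹ hu ((isOfStandardType_iff_exists_minimal hC εZ S E.etaDd).mpr hstd) hstd'
    exact eq_one_or_neg_one_of_mul_of_right (Or.inl ((mul_comm _ _).trans hum)) hpm
  · intro hcrit u hu hstd hstd'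
    obtain ⟨y, hy, m, hm, hmin, hum⟩ := (isOfStandardType_unitMul_iff hC εZ hV2 hu S E.etaDd).mp hstd'
    have hpm := hcrit ((isOfStandardType_iff_exists_minimal hC εZ S E.etaDd).mp hstd) y hy m hm hmin
      (mem_unitsOKdd_of_unit_mul_eq hu hum)
    exact eq_one_or_neg_one_of_mul_of_right hum hpm

/-- **F-0513, the criterion modulo [EtTh] Prop. 1.5 (ii)** (`Prop15ii`, FACT-LIST, BY NAME ⇒ (V2′) by
`thm110UnitClassEquivariance_of_prop15ii`). [cite: MochizukiEtTh2009, Thm 1.10 (i) p.29] -/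
theorem thm110iUnique_iff_minimal_values_of_prop15ii (hC : M.toThetaSetting.Compat) {εZ : M.GtpC}
    (hZ : M.IsAdmissibleEpsZ εZ) (E : M.toThetaSetting.EtaleThetaData)
    (S : M.StandardData E.toKummerData) (h15ii : ThetaSetting.Prop15ii E.toKummerData hC) :
    Thm110iUnique hC hZ E S ↔
      ((∃ y : ThetaSetting.NonCuspidalPoint E.toKummerData, (y = S.tau ∨ y = S.tauInv) ∧
          ∃ m ∈ valuesAt hC εZ E.etaDd y,
            (∀ w ∈ valuesAt hC εZ E.etaDd y,
              ‖((m : M.Kdd) : PadicAlgCl p)‖ ≤ ‖((w : M.Kdd) : PadicAlgCl p)‖) ∧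
            (((m : M.Kdd) : PadicAlgCl p) = 1 ∨ ((m : M.Kdd) : PadicAlgCl p) = -1)) →
        ∀ y : ThetaSetting.NonCuspidalPoint E.toKummerData, (y = S.tau ∨ y = S.tauInv) →
          ∀ m ∈ valuesAt hC εZ E.etaDd y,
            (∀ w ∈ valuesAt hC εZ E.etaDd y,
              ‖((m : M.Kdd) : PadicAlgCl p)‖ ≤ ‖((w : M.Kdd) : PadicAlgCl p)‖) →
            m ∈ M.toThetaSetting.unitsOKdd →
            (((m : M.Kdd) : PadicAlgCl p) = 1 ∨ ((m : M.Kdd) : PadicAlgCl p) = -1)) :=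
  thm110iUnique_iff_minimal_values hC hZ E S (thm110UnitClassEquivariance_of_prop15ii hC εZ h15ii)

/-- **F-0513 — THE REFUTATION SHAPE of the ∀-closure** (gen 0's «twisted `τ⁻¹`» recipe, kernel form).
Granted (V2′): if `η̈^{Θ,Z}` has the minimal value `±1` at one of the points `τ`, `τ⁻¹` (so it is of
standard type) and a UNIT minimal value `m ≠ ±1` at one of them, then `Thm110iUnique hC hZ E S` FAILS
(`u := m⁻¹` is a unit `≠ ±1` with `(u·η̈)^{Θ,Z}` of standard type). In print this cannot happen —
`V(η̈, τ⁻¹) = −V(η̈, τ)` by `Θ̈(−Ü) = −Θ̈(Ü)` (Prop. 1.4 (ii); typed as `StandardValuesInvSymm`) and the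
values at `τ` have pairwise distinct orders — but the §1 interface leaves `evalAt` at `τ⁻¹` free, so a
Kummer-carrying model decides the ∀-closure of F-0513 by exhibiting (or excluding) such a pair.
[cite: MochizukiEtTh2009, Thm 1.10 (i) p.29] -/
theorem not_thm110iUnique_of_minimal_values (hC : M.toThetaSetting.Compat) {εZ : M.GtpC}
    (hZ : M.IsAdmissibleEpsZ εZ) (E : M.toThetaSetting.EtaleThetaData)
    (S : M.StandardData E.toKummerData)
    (hV2 : Thm110UnitClassEquivariance hC εZ E.toKummerData)
    {y₁ : ThetaSetting.NonCuspidalPoint E.toKummerData} (hy₁ : y₁ = S.tau ∨ y₁ = S.tauInv)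
    {m₁ : (↥M.Kdd)ˣ} (hm₁ : m₁ ∈ valuesAt hC εZ E.etaDd y₁)
    (hmin₁ : ∀ w ∈ valuesAt hC εZ E.etaDd y₁,
      ‖((m₁ : M.Kdd) : PadicAlgCl p)‖ ≤ ‖((w : M.Kdd) : PadicAlgCl p)‖)
    (hpm₁ : ((m₁ : M.Kdd) : PadicAlgCl p) = 1 ∨ ((m₁ : M.Kdd) : PadicAlgCl p) = -1)
    {y₂ : ThetaSetting.NonCuspidalPoint E.toKummerData} (hy₂ : y₂ = S.tau ∨ y₂ = S.tauInv)
    {m₂ : (↥M.Kdd)ˣ} (hm₂ : m₂ ∈ valuesAt hC εZ E.etaDd y₂)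
    (hmin₂ : ∀ w ∈ valuesAt hC εZ E.etaDd y₂,
      ‖((m₂ : M.Kdd) : PadicAlgCl p)‖ ≤ ‖((w : M.Kdd) : PadicAlgCl p)‖)
    (hunit₂ : m₂ ∈ M.toThetaSetting.unitsOKdd)
    (hne₁ : ((m₂ : M.Kdd) : PadicAlgCl p) ≠ 1) (hne₂ : ((m₂ : M.Kdd) : PadicAlgCl p) ≠ -1) :
    ¬ Thm110iUnique hC hZ E S := fun hU =>
  ((thm110iUnique_iff_minimal_values hC hZ E S hV2).mp hU ⟨y₁, hy₁, m₁, hm₁, hmin₁, hpm₁⟩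
    y₂ hy₂ m₂ hm₂ hmin₂ hunit₂).elim hne₁ hne₂

/-! ### A value-formula-free sufficient route: (b₁) distinct orders at `τ` + (b₂) `V(τ⁻¹) = −V(τ)` -/

/-- Coercion of `−w` for a unit `w` of `K̈` (bookkeeping). [cite: MochizukiEtTh2009, §1 p.17] -/
theorem coe_units_neg (w : (↥M.Kdd)ˣ) :
    (((-w : (↥M.Kdd)ˣ) : M.Kdd) : PadicAlgCl p) = -((w : M.Kdd) : PadicAlgCl p) := by
  rw [Units.val_neg]; push_cast; ring

/-- Sign bookkeeping in `ℚ̄_p`: `a = ±b` and `b = ±1` give `a = ±1`. [folklore] -/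
private theorem eq_one_or_neg_one_of_eq_or_eq_neg {a b : PadicAlgCl p} (h : a = b ∨ a = -b)
    (hb : b = 1 ∨ b = -1) : a = 1 ∨ a = -1 := by
  rcases h with rfl | rfl <;> rcases hb with rfl | rfl
  · exact Or.inl rfl
  · exact Or.inr rfl
  · exact Or.inr rfl
  · left; ring

/-- **Transport of minimal values from `τ⁻¹` to `τ` under (b₂) `StandardValuesInvSymm`** («the 4-torsion
point `τ⁻¹` determined by `−√−1` admits a similar description», Def. 1.9; `Θ̈(−Ü) = −Θ̈(Ü)`, Prop. 1.4 (ii)):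
a minimal value `m` of `η̈^{Θ,Z}` at `y ∈ {τ, τ⁻¹}` yields a minimal value `m'` at `τ` with `m' = ±m` in
`ℚ̄_p`. [cite: MochizukiEtTh2009, Prop 1.4 (ii) p.20] -/
theorem exists_minimal_tau_of_invSymm (hC : M.toThetaSetting.Compat) (εZ : M.GtpC)
    (S : M.StandardData E) (x : M.toThetaSetting.H1 M.toThetaSetting.GtpYdd)
    (hinv : StandardValuesInvSymm hC εZ S x)
    {y : ThetaSetting.NonCuspidalPoint E} (hy : y = S.tau ∨ y = S.tauInv)
    {m : (↥M.Kdd)ˣ} (hm : m ∈ valuesAt hC εZ x y)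
    (hmin : ∀ w ∈ valuesAt hC εZ x y, ‖((m : M.Kdd) : PadicAlgCl p)‖ ≤ ‖((w : M.Kdd) : PadicAlgCl p)‖) :
    ∃ m' ∈ valuesAt hC εZ x S.tau,
      (∀ w ∈ valuesAt hC εZ x S.tau, ‖((m' : M.Kdd) : PadicAlgCl p)‖ ≤ ‖((w : M.Kdd) : PadicAlgCl p)‖) ∧
      (((m' : M.Kdd) : PadicAlgCl p) = ((m : M.Kdd) : PadicAlgCl p) ∨
        ((m' : M.Kdd) : PadicAlgCl p) = -((m : M.Kdd) : PadicAlgCl p)) := by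
  rcases hy with rfl | rfl
  · exact ⟨m, hm, hmin, Or.inl rfl⟩
  · obtain ⟨w, hw, hmw⟩ := (hinv m).mp hm
    refine ⟨w, hw, fun w' hw' => ?_, Or.inr (by rw [hmw, neg_neg])⟩
    have hnw' : -w' ∈ valuesAt hC εZ x S.tauInv := (hinv (-w')).mpr ⟨w', hw', coe_units_neg w'⟩
    have key := hmin (-w') hnw'
    rwa [hmw, norm_neg, coe_units_neg, norm_neg] at key

/-- **F-0513 from (V2′) + (b₁) + (b₂) only — NO value formula, NO orbit generator**: if the values of
`η̈^{Θ,Z}` at `τ` have pairwise distinct absolute values (`StandardValuesNormInjective`, «the UNIQUE value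
… of maximal order», Def. 1.9 (ii) with Prop. 1.4 (ii)(iii)) and the values at `τ⁻¹` are the negatives of
those at `τ` (`StandardValuesInvSymm`), then `Thm110iUnique hC hZ E S` holds. (By the criterion: all
minimal values at the two points are `±` THE minimal value at `τ`.) Weaker inputs than
`thm110iUnique_of_signedFormula` ((V1″) implies (b₁)). [cite: MochizukiEtTh2009, Thm 1.10 (i) p.29] -/
theorem thm110iUnique_of_normInjective_of_invSymm (hC : M.toThetaSetting.Compat) {εZ : M.GtpC}
    (hZ : M.IsAdmissibleEpsZ εZ) (E : M.toThetaSetting.EtaleThetaData)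
    (S : M.StandardData E.toKummerData)
    (hV2 : Thm110UnitClassEquivariance hC εZ E.toKummerData)
    (hinj : StandardValuesNormInjective hC εZ S E.etaDd)
    (hinv : StandardValuesInvSymm hC εZ S E.etaDd) :
    Thm110iUnique hC hZ E S := by
  refine (thm110iUnique_iff_minimal_values hC hZ E S hV2).mpr ?_
  rintro ⟨y₁, hy₁, m₁, hm₁, hmin₁, hpm₁⟩ y₂ hy₂ m₂ hm₂ hmin₂ -
  obtain ⟨n₁, hn₁, hminn₁, hs₁⟩ := exists_minimal_tau_of_invSymm hC εZ S E.etaDd hinv hy₁ hm₁ hmin₁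
  obtain ⟨n₂, hn₂, hminn₂, hs₂⟩ := exists_minimal_tau_of_invSymm hC εZ S E.etaDd hinv hy₂ hm₂ hmin₂
  -- two minimal values at `τ` have the same absolute value, hence coincide by (b₁)
  have heq : n₁ = n₂ :=
    hinj _ (Or.inl rfl) hn₁ hn₂ (le_antisymm (hminn₁ n₂ hn₂) (hminn₂ n₁ hn₁))
  have hn₁pm : ((n₁ : M.Kdd) : PadicAlgCl p) = 1 ∨ ((n₁ : M.Kdd) : PadicAlgCl p) = -1 :=
    eq_one_or_neg_one_of_eq_or_eq_neg hs₁ hpm₁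
  have hs₂' : ((m₂ : M.Kdd) : PadicAlgCl p) = ((n₂ : M.Kdd) : PadicAlgCl p) ∨
      ((m₂ : M.Kdd) : PadicAlgCl p) = -((n₂ : M.Kdd) : PadicAlgCl p) := by
    rcases hs₂ with h | h
    · exact Or.inl h.symm
    · exact Or.inr (by rw [h, neg_neg])
  rw [← heq] at hs₂'
  exact eq_one_or_neg_one_of_eq_or_eq_neg hs₂' hn₁pm

/-- **F-0513 from [EtTh] Prop. 1.5 (ii) + (b₁) + (b₂)** (the (V2′) input discharged by name).
[cite: MochizukiEtTh2009, Thm 1.10 (i) p.29] -/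
theorem thm110iUnique_of_normInjective_of_invSymm_of_prop15ii (hC : M.toThetaSetting.Compat)
    {εZ : M.GtpC} (hZ : M.IsAdmissibleEpsZ εZ) (E : M.toThetaSetting.EtaleThetaData)
    (S : M.StandardData E.toKummerData) (h15ii : ThetaSetting.Prop15ii E.toKummerData hC)
    (hinj : StandardValuesNormInjective hC εZ S E.etaDd)
    (hinv : StandardValuesInvSymm hC εZ S E.etaDd) :
    Thm110iUnique hC hZ E S :=
  thm110iUnique_of_normInjective_of_invSymm hC hZ E S
    (thm110UnitClassEquivariance_of_prop15ii hC εZ h15ii) hinj hinv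

end MuTwoSetting

/-! ### F-0512 `Thm110i` over ONE setting and ONE étale theta datum: the same-setting reading -/

section Thm110iSameSetting

open MuTwoSetting

variable {p : ℕ} [Fact p.Prime] {M : MuTwoSetting p} {εZ : M.GtpC} {hC : M.toThetaSetting.Compat}
  {E : M.toThetaSetting.EtaleThetaData} {γ : M.dotC εZ ≃ₜ* M.dotC εZ}

/-- **F-0512 at two standard data over the SAME setting and étale theta datum** (the shape of every
inhabited `Thm110Hypothesis` family in the tree — identity witnesses; the general `α ≠ β` case is the
K2 route `thm110i_of_matching`): for ANY hypothesis structure `H`, `Thm110i H Sα Sβ` holds iff «`±1` is a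
minimal value of `η̈^{Θ,Z}` at `τ` or `τ⁻¹`» has the same truth value for `Sα` and for `Sβ` — a condition
on the free evaluation data of the four points only. [cite: MochizukiEtTh2009, Thm 1.10 (i) p.29] -/
theorem thm110i_iff_minimal_values_of_same_setting (H : Thm110Hypothesis εZ εZ hC hC E E γ)
    (Sα Sβ : M.StandardData E.toKummerData) :
    Thm110i H Sα Sβ ↔
      ((∃ y : ThetaSetting.NonCuspidalPoint E.toKummerData, (y = Sα.tau ∨ y = Sα.tauInv) ∧
          ∃ m ∈ valuesAt hC εZ E.etaDd y,
            (∀ w ∈ valuesAt hC εZ E.etaDd y,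
              ‖((m : M.Kdd) : PadicAlgCl p)‖ ≤ ‖((w : M.Kdd) : PadicAlgCl p)‖) ∧
            (((m : M.Kdd) : PadicAlgCl p) = 1 ∨ ((m : M.Kdd) : PadicAlgCl p) = -1)) ↔
        (∃ y : ThetaSetting.NonCuspidalPoint E.toKummerData, (y = Sβ.tau ∨ y = Sβ.tauInv) ∧
          ∃ m ∈ valuesAt hC εZ E.etaDd y,
            (∀ w ∈ valuesAt hC εZ E.etaDd y,
              ‖((m : M.Kdd) : PadicAlgCl p)‖ ≤ ‖((w : M.Kdd) : PadicAlgCl p)‖) ∧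
            (((m : M.Kdd) : PadicAlgCl p) = 1 ∨ ((m : M.Kdd) : PadicAlgCl p) = -1))) := by
  unfold Thm110i
  rw [isOfStandardType_iff_exists_minimal, isOfStandardType_iff_exists_minimal]

/-- **F-0512 — the refutation shape over one setting**: if `±1` is a minimal value of `η̈^{Θ,Z}` at a point
of `Sα` but no minimal value at either point of `Sβ` is `±1`, then `Thm110i H Sα Sβ` FAILS for every
hypothesis structure `H` over the identity data (again a statement about the free `evalAt` of the
points; print pins the values by Prop. 1.4 (ii)(iii)). [cite: MochizukiEtTh2009, Thm 1.10 (i) p.29] -/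
theorem not_thm110i_of_minimal_values (H : Thm110Hypothesis εZ εZ hC hC E E γ)
    (Sα Sβ : M.StandardData E.toKummerData)
    {y : ThetaSetting.NonCuspidalPoint E.toKummerData} (hy : y = Sα.tau ∨ y = Sα.tauInv)
    {m : (↥M.Kdd)ˣ} (hm : m ∈ valuesAt hC εZ E.etaDd y)
    (hmin : ∀ w ∈ valuesAt hC εZ E.etaDd y,
      ‖((m : M.Kdd) : PadicAlgCl p)‖ ≤ ‖((w : M.Kdd) : PadicAlgCl p)‖)
    (hpm : ((m : M.Kdd) : PadicAlgCl p) = 1 ∨ ((m : M.Kdd) : PadicAlgCl p) = -1)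
    (hβ : ∀ y' : ThetaSetting.NonCuspidalPoint E.toKummerData, (y' = Sβ.tau ∨ y' = Sβ.tauInv) →
      ∀ m' ∈ valuesAt hC εZ E.etaDd y',
        (∀ w ∈ valuesAt hC εZ E.etaDd y',
          ‖((m' : M.Kdd) : PadicAlgCl p)‖ ≤ ‖((w : M.Kdd) : PadicAlgCl p)‖) →
        ((m' : M.Kdd) : PadicAlgCl p) ≠ 1 ∧ ((m' : M.Kdd) : PadicAlgCl p) ≠ -1) :
    ¬ Thm110i H Sα Sβ := fun h => by
  obtain ⟨y', hy', m', hm', hmin', hpm'⟩ :=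
    ((thm110i_iff_minimal_values_of_same_setting H Sα Sβ).mp h).mp ⟨y, hy, m, hm, hmin, hpm⟩
  exact hpm'.elim (hβ y' hy' m' hm' hmin').1 (hβ y' hy' m' hm' hmin').2

end Thm110iSameSetting

end Literature.AnabelianGeometry.EtaleTheta

end
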